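import Mathlib
import Literature.MathematicalPhysics.QuantumFieldTheory.BalabanImbrieJaffe1984to88.BIJ85Eq7112FibreEnergy
import Literature.MathematicalPhysics.QuantumFieldTheory.BalabanImbrieJaffe1984to88.BIJ85Eq7116SurfaceAverage

/-!
# `BalabanImbrieJaffe1984to88.BIJ85Eq7118Intertwining` — T. Bałaban, J. Imbrie, A. Jaffe, *Renormalization of the Higgs model:
minimizers, propagators and the stability of mean field theory*, Commun. Math. Phys. **97** (1985) 299–329 [BalabanImbrieJaffe1985]:
Sect. 7.1 p. 323 — **"Furthermore Q^{e*}_k∂ = ∂Q^{s*}_k, so τ₁∂ = Q^e_k(I − P_∂)∂Q^{s*}_k = 0. (7.1.18)"** — the INTERTWINING of the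
unit-lattice curl `∂ = ∂^{(1)}` and the η-lattice curl `∂ = ∂^η` by the k-fold edge and surface adjoints, PROVED for the CONCRETE
configuration-space operators of `BIJ85Eq7111EdgeAverage`/`BIJ85Eq7116SurfaceAverage` on the tori, both as an operator identity and
FIBREWISE (the symbol identity `conj(∂^{(1)}-curl(p′))·w(p′+l) = n·s(p′+l)·conj(∂-curl(p′+l))` at every `p′ + l`), together with the
structural (7.1.18) `τ₁∂ = 0` for `τ₁ = Q^e_k(I − P)Q^{e*}_k` and ANY `P` with `(I − P)∂^η = 0` — file 15 of the (7.1.2) cluster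

statement-level skeleton of published theorems with citation tags; proofs where landed; nothing here is a claim about
the Yang–Mills mass gap

PDF held: `paper:balaban1985-cmp97-bij-higgs-minimizers` (journal page = PDF page + 298).  Text read as image: PDF p. 25 (journal
323; `run/shared/lean/pub/pub-balaban/t4/b2b-balaban-t4-lit2/renders/bij1985/1985-cmp97-bij-higgs-minimizers-p025-x2.png`).

CITATION HEADER (lean-in-tree rule).  Part of the lit-balaban TYPED SKELETON (HOME `run/shared/lean/pub/lit-balaban/`); WHAT IS
REPRODUCED: the sentence and display **(7.1.18)** of SKELETON row **C1.Eq7.1.13-7.1.19** (p. 323 [PDF 25], verbatim: *"The fact that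
τ₁ vanishes on curls can be established as follows: The general form of τ₁ in configuration space is evident from (7.1.11), (7.1.14)
namely τ₁ = Q^e_k(I − P_∂)Q^{e*}_k, (7.1.17) where P_∂ denotes the orthogonal projection onto curls. … Furthermore Q^{e*}_k∂ = ∂Q^{s*}_k,
so τ₁∂ = Q^e_k(I − P_∂)∂Q^{s*}_k = 0. (7.1.18)"*; the same intertwining is used at (4.3.2) p. 311 *"we use ∂Q^{s*}_k = Q^{e*}_k∂"*),
`HOME/lit-balaban-r15/ROWS-C1.md` (owner r15, referee ref-5; r15's `BIJ85MomentumSymbols71.eq7118` is the abstract-module form of the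
implication, seats p19/p31's `BIJ85CurlQsstar.curl_Qsstar`/`BIJ85Eq531Inputs.curl_QsstarIter` prove the intertwining on the `Setup`
tori; here: the `Tor`-carrier operators whose Fourier symbols are (7.1.11)/(7.1.16)).  TYPED READING: unit curl `∂^{(1)}` = gen-4's
`BIJ85Eq715ConfigSymbols.curlC M` (bond fields `Tor M × Fin d` → plaquette fields `Tor M × (Fin d × Fin d)`, ordered orientation pairs,
`(∂B)_{λκ}(y) = B_κ(y+e_λ) − B_κ(y) − B_λ(y+e_κ) + B_λ(y)`), η-curl `∂^η = η^{−1}·curlC (fine n M) = n·curlC (fine n M)`, `Q^{e*}_k =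
edgeAdjC`, `Q^{s*}_k = surfAdjC` (the weighted adjoints `η^{−d}(·)ᴴ`).
WHAT IS KERNEL-CHECKED (zero `sorry`, standard axioms; `chi_pOf_unitVec` from `BIJ85Eq7112FibreEnergy`): `isTranslInvR_curlC`, **`symbR_curlC`** (the symbol of the curl:
`δ_{ρκ}(e^{ip·e_λ} − 1) − δ_{ρλ}(e^{ip·e_κ} − 1)`), the scalar **`key_identity`** `conj(∂^{(1)}_λ(p′))·w_{λκ}(p) = n·s_κ(p)·conj(ω_λ − 1)`
(`∂^{(1)}_λ = v_λ∂_λ` and the phase identity `ω^{n−1}v̄ = v`), the fibrewise identity **`symbX_intertwine`**, the operator identities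
**`curlAdj_edgeAvg_eq`** `(∂^{(1)})ᴴQ^e_k = n·Q^s_k(∂^{η,1})ᴴ` and **`edgeAdj_curl_eq_curl_surfAdj`** `Q^{e*}_k∂^{(1)} = ∂^ηQ^{s*}_k` (the
printed one; `edgeAdj_curl_mulVec` pointwise), and **(7.1.18) `tau1_curl_eq_zero`**: `Q^e_k(I − P)Q^{e*}_k∂^{(1)} = 0` whenever
`(I − P)∂^η = 0`.  NOT CLAIMED: the orthogonal projection `P_∂` itself and (7.1.17) as an identification of τ₁'s symbol (7.1.14)
(seat p10's `BIJ85Eq7113Derivation`).  Unit `lit-balaban-p27` (gen 5), HOME as above.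
-/

namespace Literature.MathematicalPhysics.QuantumFieldTheory.BalabanImbrieJaffe1984to88.BIJ85Eq7118Intertwining

open scoped BigOperators Matrix ComplexConjugate
open Finset Complex
open Literature.MathematicalPhysics.QuantumFieldTheory.Balaban1983to89
open Literature.MathematicalPhysics.QuantumFieldTheory.Balaban1983to89.B5Prop11Plancherel
open Literature.MathematicalPhysics.QuantumFieldTheory.Balaban1983to89.B5Prop11Fiber
open Literature.MathematicalPhysics.QuantumFieldTheory.Balaban1983to89.B5Block118
open Literature.MathematicalPhysics.QuantumFieldTheory.BalabanImbrieJaffe1984to88.BIJ85Eq712Plancherel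
open Literature.MathematicalPhysics.QuantumFieldTheory.BalabanImbrieJaffe1984to88.BIJ85Eq712SymbolCalculus
open Literature.MathematicalPhysics.QuantumFieldTheory.BalabanImbrieJaffe1984to88.BIJ85Eq715ConfigSymbols
open Literature.MathematicalPhysics.QuantumFieldTheory.BalabanImbrieJaffe1984to88.BIJ85Eq7111CrossSymbols
open Literature.MathematicalPhysics.QuantumFieldTheory.BalabanImbrieJaffe1984to88.BIJ85Eq7111EdgeAverage
open Literature.MathematicalPhysics.QuantumFieldTheory.BalabanImbrieJaffe1984to88.BIJ85Eq7111EdgeAdjoint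
open Literature.MathematicalPhysics.QuantumFieldTheory.BalabanImbrieJaffe1984to88.BIJ85Eq7116SurfaceAverage
open Literature.MathematicalPhysics.QuantumFieldTheory.BalabanImbrieJaffe1984to88.BIJ85Eq7112FibreEnergy

noncomputable section

/-! ## §1 The curl is translation invariant; its symbol -/

section Curl

variable {d : ℕ} (N : Fin d → ℕ) [hN : ∀ μ, NeZero (N μ)]

omit hN in
/-- The lattice curl `∂` (`curlC`) is translation invariant. [cite: BalabanImbrieJaffe1985, (7.1.13) p.322] -/
theorem isTranslInvR_curlC : IsTranslInvR N (Fin d × Fin d) (Fin d) (curlC N) := by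
  intro a x y i j
  simp only [curlC, Matrix.of_apply, Prod.mk.injEq, add_right_comm x a, add_left_inj]

/-- kernel: `Σ_z [(0,ρ) = (z + e, κ)] conj e^{iq·z} = δ_{ρκ} e^{iq·e}`. [folklore] -/
private theorem sum_ite_shift_mul_conj_chi (q e : Tor N) (ρ κ : Fin d) :
    ∑ z : Tor N, (if ((0 : Tor N), ρ) = (z + e, κ) then (1 : ℂ) else 0) * conj (chi N q z)
      = if ρ = κ then chi N q e else 0 := by
  rw [Finset.sum_eq_single (-e)]
  · simp only [neg_add_cancel, Prod.mk.injEq, true_and]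
    split_ifs with h
    · rw [one_mul, conj_chi, chi_neg_neg]
    · rw [zero_mul]
  · intro z _ hz
    rw [if_neg, zero_mul]
    intro h
    exact hz (eq_neg_of_add_eq_zero_left ((Prod.mk.inj h).1).symm)
  · exact fun h => absurd (Finset.mem_univ _) h

/-- kernel: `Σ_z [(0,ρ) = (z, κ)] conj e^{iq·z} = δ_{ρκ}`. [folklore] -/
private theorem sum_ite_mul_conj_chi (q : Tor N) (ρ κ : Fin d) :
    ∑ z : Tor N, (if ((0 : Tor N), ρ) = (z, κ) then (1 : ℂ) else 0) * conj (chi N q z) = if ρ = κ then 1 else 0 := by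
  have h := sum_ite_shift_mul_conj_chi N q 0 ρ κ
  simp only [add_zero] at h
  rw [h]
  split_ifs
  · unfold chi; simp
  · rfl

/-- **The symbol of the curl**: `σ_∂(q)_{(λκ),ρ} = δ_{ρκ}(e^{iq·e_λ} − 1) − δ_{ρλ}(e^{iq·e_κ} − 1)` — on the unit torus `e^{iq·e_λ} − 1 =
∂^{(1)}_λ(p′)` (7.1.5), on the η-torus `= η∂_λ(p)` (7.1.4) (cf. `BIJ85Eq715ConfigSymbols.dftC_curlC_mulVec`, r15's `curlOne`).
[cite: BalabanImbrieJaffe1985, (7.1.5) p.322] -/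
theorem symbR_curlC (q : Tor N) (l κ ρ : Fin d) :
    symbR N (Fin d × Fin d) (Fin d) (curlC N) q (l, κ) ρ
      = (if ρ = κ then chi N q (unitVec N l) - 1 else 0) - (if ρ = l then chi N q (unitVec N κ) - 1 else 0) := by
  rw [symbR_apply]
  simp only [curlC, Matrix.of_apply, sub_mul, Finset.sum_sub_distrib, sum_ite_shift_mul_conj_chi, sum_ite_mul_conj_chi]
  split_ifs <;> ring

end Curl

/-! ## §2 The fibrewise identity behind `Q^{e*}_k∂ = ∂Q^{s*}_k` -/

section Fibre

variable {d : ℕ} (n : ℕ) [NeZero n] (M : Fin d → ℕ) [hM : ∀ μ, NeZero (M μ)]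

/-- kernel: on the unit torus, `e^{iq·e_λ} − 1 = ∂^{(1)}_λ(p′) = d1Sym`. [cite: BalabanImbrieJaffe1985, (7.1.5) p.322] -/
theorem chi_unitVec_sub_one (q : Tor M) (l : Fin d) : chi M q (unitVec M l) - 1 = d1Sym (sOf M q) l := by
  rw [chi_unitVec_eq_exp, d1Sym, mul_comm]

omit hM in
/-- kernel: the edge weight is symmetric in the orientation pair. [cite: BalabanImbrieJaffe1985, (7.1.11) p.322] -/
theorem edgeW_comm (k : Fin d → Fin n) (s : Fin d → ℝ) (μ ν : Fin d) : edgeW n k s μ ν = edgeW n k s ν μ := by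
  unfold edgeW edgeSlots
  simp_rw [or_comm (a := _ = μ)]

omit hM in
/-- **THE KEY SCALAR IDENTITY** (`λ ≠ κ`): `conj(∂^{(1)}_λ(p′))·w_{λκ}(p) = n·s_κ(p)·conj(ω_λ − 1)` at `p = p′ + l` — i.e.
`conj(∂^{(1)}_λ)·u/(v̄_λv̄_κ) = (u/v̄_κ)·conj(∂_λ)`, by `∂^{(1)}_λ = v_λ∂_λ` ((7.1.7), `B5Prop11Fiber.d1Sym_eq_vSym_mul`) and the phase
identity `ω_λ^{n−1}v̄_λ = v_λ` (`om_pow_mul_conj_vSym`). [cite: BalabanImbrieJaffe1985, (7.1.18) p.323] -/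
theorem key_identity (k : Fin d → Fin n) (q : Tor M) {l κ : Fin d} (hlκ : l ≠ κ) :
    conj (d1Sym (sOf M q) l) * edgeW n k (sOf M q) l κ
      = (n : ℂ) * surfW n k (sOf M q) κ * conj (om n k (sOf M q) l - 1) := by
  have hn1 : 1 ≤ n := Nat.one_le_iff_ne_zero.mpr (NeZero.ne n)
  have hl : l ∈ Finset.univ.erase κ := Finset.mem_erase.mpr ⟨hlκ, Finset.mem_univ l⟩
  have hphase := om_pow_mul_conj_vSym n M k q l
  rw [edgeW_eq n M k q hlκ, surfW_eq, ← Finset.mul_prod_erase _ _ hl, Finset.erase_right_comm,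
    d1Sym_eq_vSym_mul n hn1 k (sOf M q) l, dSym_eq_om, map_mul, map_mul, Complex.conj_natCast]
  calc conj (vSym n k (sOf M q) l) * ((n : ℂ) * conj (om n k (sOf M q) l - 1))
        * (om n k (sOf M q) l ^ (n - 1) * om n k (sOf M q) κ ^ (n - 1)
          * ∏ ρ ∈ (Finset.univ.erase κ).erase l, vSym n k (sOf M q) ρ)
      = (n : ℂ) * (om n k (sOf M q) κ ^ (n - 1) * ((om n k (sOf M q) l ^ (n - 1) * conj (vSym n k (sOf M q) l))
          * ∏ ρ ∈ (Finset.univ.erase κ).erase l, vSym n k (sOf M q) ρ)) * conj (om n k (sOf M q) l - 1) := by ring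
    _ = (n : ℂ) * (om n k (sOf M q) κ ^ (n - 1) * (vSym n k (sOf M q) l
          * ∏ ρ ∈ (Finset.univ.erase κ).erase l, vSym n k (sOf M q) ρ)) * conj (om n k (sOf M q) l - 1) := by
        rw [hphase]

/-- **THE FIBREWISE INTERTWINING** at `p = p′ + l`: for every bond direction `ρ` and orientation `(λ,κ)`,
`conj(σ_{∂^{(1)}}(p′)_{(λκ),ρ})·w_{λκ}(p) = n·s_ρ(p)·conj(σ_{curl}(p)_{(λκ),ρ})` — the symbol form of `Q^{e*}_k∂ = ∂Q^{s*}_k` (the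
`l`-th block of `(∂^{(1)})ᴴQ^e_k = Q^s_k(∂^η)ᴴ` in momentum space). [cite: BalabanImbrieJaffe1985, (7.1.18) p.323] -/
theorem symbX_intertwine (k : Fin d → Fin n) (q : Tor M) (l κ ρ : Fin d) :
    conj (symbR M (Fin d × Fin d) (Fin d) (curlC M) q (l, κ) ρ) * edgeW n k (sOf M q) l κ
      = (n : ℂ) * surfW n k (sOf M q) ρ
          * conj (symbR (fine n M) (Fin d × Fin d) (Fin d) (curlC (fine n M)) (pOf n M (k, q)) (l, κ) ρ) := by
  rw [symbR_curlC, symbR_curlC, chi_unitVec_sub_one, chi_unitVec_sub_one, chi_pOf_unitVec, chi_pOf_unitVec]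
  by_cases hlκ : l = κ
  · subst hlκ
    split_ifs <;> simp
  · by_cases hρκ : ρ = κ
    · subst hρκ
      rw [if_pos rfl, if_neg (Ne.symm hlκ), if_pos rfl, if_neg (Ne.symm hlκ), sub_zero, sub_zero]
      exact key_identity n M k q hlκ
    · by_cases hρl : ρ = l
      · subst hρl
        rw [if_neg hρκ, if_pos rfl, if_neg hρκ, if_pos rfl, zero_sub, zero_sub, map_neg, map_neg, edgeW_comm,
          neg_mul, mul_neg, key_identity n M k q (Ne.symm hlκ)]
      · rw [if_neg hρκ, if_neg hρl, if_neg hρκ, if_neg hρl, sub_zero, map_zero, zero_mul, mul_zero]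

end Fibre

/-! ## §3 The operator identities `(∂^{(1)})ᴴQ^e_k = n·Q^s_k(∂)ᴴ` and `Q^{e*}_k∂^{(1)} = ∂^ηQ^{s*}_k` -/

section Operator

variable {d : ℕ} (n : ℕ) [NeZero n] (M : Fin d → ℕ) [hM : ∀ μ, NeZero (M μ)]
variable {m m' : Type*} [Fintype m] [DecidableEq m] [Fintype m'] [DecidableEq m']

omit [Fintype m] [DecidableEq m] [Fintype m'] [DecidableEq m'] in
/-- scalar multiples pass through the cross symbol. [cite: BalabanImbrieJaffe1985, (7.1.11) p.322] -/
theorem symbX_smul (c : ℂ) (T : Matrix (Tor M × m) (Tor (fine n M) × m') ℂ) (p : Tor (fine n M)) :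
    symbX n M m m' (c • T) p = c • symbX n M m m' T p := by
  ext i j
  simp only [symbX_apply, Matrix.smul_apply, smul_eq_mul, Finset.mul_sum, mul_assoc]

/-- A translation-invariant cross-lattice operator is determined by its symbols. [cite: BalabanImbrieJaffe1985, (7.1.11) p.322] -/
theorem eq_of_symbX_eq {T S : Matrix (Tor M × m) (Tor (fine n M) × m') ℂ} (hT : IsCrossTI n M m m' T)
    (hS : IsCrossTI n M m m' S) (h : ∀ p, symbX n M m m' T p = symbX n M m m' S p) : T = S := by
  rw [eq_star_dftC_mul_crossFibre_mul_dftC n M m m' hT, eq_star_dftC_mul_crossFibre_mul_dftC n M m m' hS]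
  simp_rw [h]

/-- **`(∂^{(1)})ᴴ Q^e_k = n·Q^s_k (∂^{η,1})ᴴ`** (`∂^{η,1}` = `curlC` on the η-torus with unit differences, so `n·∂^{η,1} = ∂^η`): the co-curl
form of *"Q^{e*}_k∂ = ∂Q^{s*}_k"*, PROVED for the concrete operators by comparing symbols fibre by fibre (`symbX_intertwine`).
[cite: BalabanImbrieJaffe1985, (7.1.18) p.323] -/
theorem curlAdj_edgeAvg_eq :
    (curlC M)ᴴ * edgeAvgC n M = (n : ℂ) • (surfAvgC n M * (curlC (fine n M))ᴴ) := by
  have h1 : IsCrossTI n M (Fin d) (Fin d × Fin d) ((curlC M)ᴴ * edgeAvgC n M) :=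
    IsCrossTI.mul_left (isTranslInvR_curlC M).conjTranspose (isCrossTI_edgeAvgC n M)
  have h2 : IsCrossTI n M (Fin d) (Fin d × Fin d) ((n : ℂ) • (surfAvgC n M * (curlC (fine n M))ᴴ)) :=
    (IsCrossTI.mul_right (isCrossTI_surfAvgC n M) (isTranslInvR_curlC (fine n M)).conjTranspose).smul _
  refine eq_of_symbX_eq n M h1 h2 fun p => ?_
  obtain ⟨⟨k, q⟩, rfl⟩ := (pOf_bijective n M).2 p
  rw [symbX_mul_left n M (Fin d) (Fin d × Fin d) (Fin d × Fin d) (isTranslInvR_curlC M).conjTranspose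
      (isCrossTI_edgeAvgC n M), symbR_conjTranspose M (Fin d × Fin d) (Fin d) (isTranslInvR_curlC M), coarse_pOf, symbX_smul,
    symbX_mul_right n M (Fin d) (Fin d) (Fin d × Fin d) (isCrossTI_surfAvgC n M) (isTranslInvR_curlC (fine n M)).conjTranspose,
    symbR_conjTranspose (fine n M) (Fin d × Fin d) (Fin d) (isTranslInvR_curlC (fine n M))]
  ext ρ ⟨l, κ⟩
  rw [Matrix.mul_apply, Fintype.sum_prod_type, Finset.sum_eq_single l, Finset.sum_eq_single κ, Matrix.smul_apply,
    Matrix.mul_apply, Finset.sum_eq_single ρ]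
  · rw [Matrix.conjTranspose_apply, symbX_edgeAvgC_pOf, if_pos rfl, symbX_surfAvgC_pOf, if_pos rfl,
      Matrix.conjTranspose_apply, smul_eq_mul, ← mul_assoc]
    exact symbX_intertwine n M k q l κ ρ
  · intro ρ' _ hρ'
    rw [symbX_surfAvgC_pOf, if_neg hρ', zero_mul]
  · exact fun h => absurd (Finset.mem_univ _) h
  · intro κ' _ hκ'
    rw [symbX_edgeAvgC_pOf, if_neg (fun h => hκ' (Prod.mk.inj h).2.symm), mul_zero]
  · exact fun h => absurd (Finset.mem_univ _) h
  · intro l' _ hl'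
    refine Finset.sum_eq_zero fun κ' _ => ?_
    rw [symbX_edgeAvgC_pOf, if_neg (fun h => hl' (Prod.mk.inj h).1.symm), mul_zero]
  · exact fun h => absurd (Finset.mem_univ _) h

/-- **"Q^{e*}_k∂ = ∂Q^{s*}_k"** p. 323 (and (4.3.2) p. 311), PROVED for the concrete operators: `Q^{e*}_k ∂^{(1)} = ∂^η Q^{s*}_k` with
`Q^{e*}_k = edgeAdjC`, `∂^{(1)} = curlC M`, `∂^η = n·curlC (fine n M)`, `Q^{s*}_k = surfAdjC`. [cite: BalabanImbrieJaffe1985, (7.1.18) p.323] -/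
theorem edgeAdj_curl_eq_curl_surfAdj :
    edgeAdjC n M * curlC M = ((n : ℂ) • curlC (fine n M)) * surfAdjC n M := by
  have h := congrArg Matrix.conjTranspose (curlAdj_edgeAvg_eq n M)
  rw [Matrix.conjTranspose_mul, Matrix.conjTranspose_conjTranspose, Matrix.conjTranspose_smul, Matrix.conjTranspose_mul,
    Matrix.conjTranspose_conjTranspose, Complex.star_def, Complex.conj_natCast] at h
  rw [edgeAdjC, surfAdjC, Matrix.smul_mul, h, Matrix.smul_mul, Matrix.mul_smul, smul_smul, smul_smul, mul_comm]

/-- pointwise: `(Q^{e*}_k ∂^{(1)}B)(x) = (∂^η Q^{s*}_kB)(x)` for every unit-lattice bond field `B` and every η-plaquette.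
[cite: BalabanImbrieJaffe1985, (7.1.18) p.323] -/
theorem edgeAdj_curl_mulVec (B : Tor M × Fin d → ℂ) :
    edgeAdjC n M *ᵥ (curlC M *ᵥ B) = (n : ℂ) • (curlC (fine n M) *ᵥ (surfAdjC n M *ᵥ B)) := by
  rw [Matrix.mulVec_mulVec, Matrix.mulVec_mulVec, edgeAdj_curl_eq_curl_surfAdj, Matrix.smul_mul, Matrix.smul_mulVec]

/-- **(7.1.18)** p. 323, *"so τ₁∂ = Q^e_k(I − P_∂)∂Q^{s*}_k = 0"*: for `τ₁ = Q^e_k(I − P)Q^{e*}_k` (7.1.17) with ANY operator `P` on η-plaquette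
fields satisfying `(I − P)∂^η = 0` (as the orthogonal projection `P_∂` onto curls does), `τ₁∂^{(1)} = 0` — τ₁ vanishes on curls.
[cite: BalabanImbrieJaffe1985, (7.1.18) p.323] -/
theorem tau1_curl_eq_zero (P : Matrix (Tor (fine n M) × (Fin d × Fin d)) (Tor (fine n M) × (Fin d × Fin d)) ℂ)
    (hP : (1 - P) * curlC (fine n M) = 0) :
    edgeAvgC n M * (1 - P) * edgeAdjC n M * curlC M = 0 := by
  rw [Matrix.mul_assoc, edgeAdj_curl_eq_curl_surfAdj, Matrix.smul_mul, Matrix.mul_smul, Matrix.mul_assoc,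
    ← Matrix.mul_assoc (1 - P), hP, Matrix.zero_mul, Matrix.mul_zero, smul_zero]

end Operator

end

end Literature.MathematicalPhysics.QuantumFieldTheory.BalabanImbrieJaffe1984to88.BIJ85Eq7118Intertwining
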